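import Summits.NavierStokesRegularity.OSWSelfSimilar.SheetRCayleyHilbert
import HarnessLib

/-!
# SHEET-ℝ frame: the Hilbert transform of the pure Cayley modes, `H[sin kθ] = −(cos kθ − (−1)^k)`, `H[cos kθ − (−1)^k] = sin kθ`

HONEST FRAMING (cell ns-blowup GROUP B / zone Z3, case Z3-SR-CERT; 1-D MODEL certificate frame; not Euler/NS).

Companion of `SheetRCayleyHilbert.lean` ((E2) for the frame `e_n = (1 + cos θ) sin nθ`). The certificate's CENTRE `Ω̄` is a finite SINE series
in the Cayley angle `θ = 2·arctan(ξ/L)` (cert-1 `SHEET-R-PRICE-impl1.md` §4 T1; eng-3's payload), and the engines evaluate `HΩ̄` through the closed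
form `H[sin kθ] = −(cos kθ − (−1)^k)` (PRICE §1 (E2) «from eng-3's H[sin kθ] = −(cos kθ − (−1)^k)»). This file makes that closed form a kernel
theorem for every `k ≥ 1` (`hilbertTransform_sin_cayleyAngle`, `hilbertTransform_cos_sub_cayleyAngle`), `H = Literature.Analysis.Fourier.hilbertTransform`
(convention `H cos = sin`). Mechanism: with `w = L − iξ`, `e^{ikθ} = ((2L − w)/w)^k`, so
`e^{ikθ} − (−1)^k = 2kL(−1)^{k−1}·w^{−1} + ∑_{2≤j≤k} C(k,j)(2L)^j(−1)^{k−j}·w^{−j}` (`cexp_mul_cayleyAngle_sub_eq_sum`); the `w^{−1}` mode is NOT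
integrable but satisfies the pair `H(Re ·) = Im ·`, `H(Im ·) = −Re ·` (the Poisson pair, `hilbertTransform_cayleyInvPow` at `k = 1`) with absolutely
convergent symmetric integrands, so the pair extends to the span with the `w^{−1}` mode (`hilbertTransform_cayleySum_one`). The constant `(−1)^k = cos kπ`
is the value of `cos kθ` at `ξ = ±∞`, invisible to the line transform of the decaying `sin kθ`. Pure calculus about explicit functions; no definition,
no named fact; MODEL frame bookkeeping only.
-/

noncomputable section

namespace Summit.NavierStokesRegularity.OSWSelfSimilar
namespace SheetRCayleyHilbertModes

open _root_.MeasureTheory _root_.Set _root_.Filter _root_.Complex Literature.Analysis.Fourier SheetRCayleyHilbert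
open scoped Real Topology

/-! ### §1 Symmetric-integrand bookkeeping for the non-integrable mode `w^{-1}` -/

/-- Symmetric-integrand bookkeeping: from `f` to `c·f`. [folklore] -/
private theorem symm_const_mul {f : ℝ → ℝ} {x : ℝ} (c : ℝ)
    (hint : IntegrableOn (fun t => (f (x - t) - f (x + t)) / t) (Ioi 0)) :
    IntegrableOn (fun t => (c * f (x - t) - c * f (x + t)) / t) (Ioi 0) := by
  refine IntegrableOn.congr_fun (hint.const_mul c) (fun t _ => ?_) measurableSet_Ioi
  ring

/-- Symmetric-integrand bookkeeping: from an integrable `f` to `y ↦ y·f(y)`. [folklore] -/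
private theorem symm_mul_id {f : ℝ → ℝ} {x : ℝ} (hf : Integrable f)
    (hint : IntegrableOn (fun t => (f (x - t) - f (x + t)) / t) (Ioi 0)) :
    IntegrableOn (fun t => ((x - t) * f (x - t) - (x + t) * f (x + t)) / t) (Ioi 0) := by
  have hA : Integrable (fun t => f (x - t)) := hf.comp_sub_left x
  have hB : Integrable (fun t => f (x + t)) := hf.comp_add_left x
  refine IntegrableOn.congr_fun ((hint.const_mul x).sub (hA.add hB).integrableOn) (fun t ht => ?_)
    measurableSet_Ioi
  have ht0 : t ≠ 0 := ne_of_gt ht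
  simp only [Pi.add_apply, Pi.sub_apply]
  field_simp
  ring

/-- `(L − iξ)⁻¹ = (L + iξ)/(L² + ξ²)`: real part. [folklore] -/
private theorem inv_cayleyDen_re' (L ξ : ℝ) : ((((L : ℂ) - I * ξ) ^ 1)⁻¹).re = L * (L ^ 2 + ξ ^ 2)⁻¹ := by
  have h : ‖(L : ℂ) - I * ξ‖ ^ 2 = L ^ 2 + ξ ^ 2 := by
    rw [Complex.sq_norm, Complex.normSq_apply]; simp; ring
  rw [pow_one, Complex.inv_re, ← Complex.sq_norm, h]
  simp [div_eq_mul_inv]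

/-- `(L − iξ)⁻¹`: imaginary part. [folklore] -/
private theorem inv_cayleyDen_im' (L ξ : ℝ) : ((((L : ℂ) - I * ξ) ^ 1)⁻¹).im = ξ * (L ^ 2 + ξ ^ 2)⁻¹ := by
  have h : ‖(L : ℂ) - I * ξ‖ ^ 2 = L ^ 2 + ξ ^ 2 := by
    rw [Complex.sq_norm, Complex.normSq_apply]; simp; ring
  rw [pow_one, Complex.inv_im, ← Complex.sq_norm, h]
  simp [div_eq_mul_inv]

/-- The symmetric Hilbert integrands of BOTH parts of `b·(L − iξ)⁻¹` converge absolutely at every `x` (the real part is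
`C¹ ∩ L¹`; the imaginary part is `ξ` times a `C¹ ∩ L¹` function). [folklore] -/
private theorem symm_cayleyInv {L : ℝ} (hL : 0 < L) (b x : ℝ) :
    IntegrableOn (fun t => ((((b : ℝ) : ℂ) * (((L : ℂ) - I * ↑(x - t)) ^ 1)⁻¹).re -
        (((b : ℝ) : ℂ) * (((L : ℂ) - I * ↑(x + t)) ^ 1)⁻¹).re) / t) (Ioi 0) ∧
      IntegrableOn (fun t => ((((b : ℝ) : ℂ) * (((L : ℂ) - I * ↑(x - t)) ^ 1)⁻¹).im -
        (((b : ℝ) : ℂ) * (((L : ℂ) - I * ↑(x + t)) ^ 1)⁻¹).im) / t) (Ioi 0) := by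
  have hf : Integrable fun ξ : ℝ => (L ^ 2 + ξ ^ 2)⁻¹ := SheetRWeightedEmbeddings.integrable_inv_sq_add_sq hL
  have hfC : ContDiff ℝ 1 fun ξ : ℝ => (L ^ 2 + ξ ^ 2)⁻¹ := by
    refine ContDiff.inv (by fun_prop) fun ξ => ?_
    positivity
  have hs : IntegrableOn (fun t => ((L ^ 2 + (x - t) ^ 2)⁻¹ - (L ^ 2 + (x + t) ^ 2)⁻¹) / t) (Ioi 0) :=
    integrableOn_symmIntegrand_of_contDiff hfC hf x
  have hre := symm_const_mul (f := fun ξ : ℝ => (L ^ 2 + ξ ^ 2)⁻¹) (b * L) hs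
  have hxs : IntegrableOn (fun t => ((x - t) * (L ^ 2 + (x - t) ^ 2)⁻¹ - (x + t) * (L ^ 2 + (x + t) ^ 2)⁻¹) / t)
      (Ioi 0) := symm_mul_id (f := fun ξ : ℝ => (L ^ 2 + ξ ^ 2)⁻¹) hf hs
  have him := symm_const_mul (f := fun ξ : ℝ => ξ * (L ^ 2 + ξ ^ 2)⁻¹) b hxs
  refine ⟨IntegrableOn.congr_fun hre (fun t _ => ?_) measurableSet_Ioi,
    IntegrableOn.congr_fun him (fun t _ => ?_) measurableSet_Ioi⟩
  · simp only [Complex.re_ofReal_mul, inv_cayleyDen_re']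
    ring
  · simp only [Complex.im_ofReal_mul, inv_cayleyDen_im']

/-- The span WITH the non-integrable mode `w^{-1}`: the pair `H(Re F) = Im F`, `H(Im F) = −Re F` for
`F = b·(L − iξ)^{−1} + ∑_{j<n} c_j (L − iξ)^{−(j+2)}` (`b, c_j ∈ ℝ`). [folklore] -/
theorem hilbertTransform_cayleySum_one {L : ℝ} (hL : 0 < L) (b : ℝ) (c : ℕ → ℝ) (n : ℕ) (x : ℝ) :
    hilbertTransform (fun ξ : ℝ => ((b : ℂ) * (((L : ℂ) - I * ξ) ^ 1)⁻¹ +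
        ∑ j ∈ Finset.range n, (c j : ℂ) * (((L : ℂ) - I * ξ) ^ (j + 2))⁻¹).re) x =
      ((b : ℂ) * (((L : ℂ) - I * x) ^ 1)⁻¹ +
        ∑ j ∈ Finset.range n, (c j : ℂ) * (((L : ℂ) - I * x) ^ (j + 2))⁻¹).im ∧
    hilbertTransform (fun ξ : ℝ => ((b : ℂ) * (((L : ℂ) - I * ξ) ^ 1)⁻¹ +
        ∑ j ∈ Finset.range n, (c j : ℂ) * (((L : ℂ) - I * ξ) ^ (j + 2))⁻¹).im) x =
      -((b : ℂ) * (((L : ℂ) - I * x) ^ 1)⁻¹ +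
        ∑ j ∈ Finset.range n, (c j : ℂ) * (((L : ℂ) - I * x) ^ (j + 2))⁻¹).re := by
  have hSC : ContDiff ℝ 1 (fun ξ : ℝ => ∑ j ∈ Finset.range n, (c j : ℂ) * (((L : ℂ) - I * ξ) ^ (j + 2))⁻¹) :=
    ContDiff.sum fun j _ => contDiff_const.mul (contDiff_cayleyInvPow hL (j + 2))
  have hSi : Integrable (fun ξ : ℝ => ∑ j ∈ Finset.range n, (c j : ℂ) * (((L : ℂ) - I * ξ) ^ (j + 2))⁻¹) :=
    integrable_finsetSum _ fun j _ => (integrable_cayleyInvPow hL (by omega : 2 ≤ j + 2)).const_mul _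
  obtain ⟨h1, h2⟩ := symm_cayleyInv hL b x
  exact hilbertTransform_reIm_add
    (F := fun ξ : ℝ => (b : ℂ) * (((L : ℂ) - I * ξ) ^ 1)⁻¹)
    (G := fun ξ : ℝ => ∑ j ∈ Finset.range n, (c j : ℂ) * (((L : ℂ) - I * ξ) ^ (j + 2))⁻¹)
    h1 h2
    (integrableOn_symmIntegrand_of_contDiff (Complex.reCLM.contDiff.comp hSC) hSi.re x)
    (integrableOn_symmIntegrand_of_contDiff (Complex.imCLM.contDiff.comp hSC) hSi.im x)
    (hilbertTransform_reIm_ofReal_mul b (hilbertTransform_cayleyInvPow hL le_rfl x))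
    (hilbertTransform_cayleySum hL c n x)

/-- **`e^{ikθ} − (−1)^k` in the span** (`k = m + 1 ≥ 1`, `θ = 2·arctan(ξ/L)`, `w = L − iξ`):
`e^{i(m+1)θ} − (−1)^{m+1} = 2(m+1)L(−1)^m·w^{−1} + ∑_{i<m} C(m+1, i+2)(2L)^{i+2}(−1)^{m−1−i}·w^{−(i+2)}`. [folklore] -/
theorem cexp_mul_cayleyAngle_sub_eq_sum {L : ℝ} (hL : 0 < L) (m : ℕ) (ξ : ℝ) :
    Complex.exp (((((m + 1 : ℕ) : ℝ) * (2 * Real.arctan (ξ / L)) : ℝ) : ℂ) * I) - (-1) ^ (m + 1) =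
      (((2 * (m + 1) * L * (-1) ^ m : ℝ)) : ℂ) * (((L : ℂ) - I * ξ) ^ 1)⁻¹ +
        ∑ i ∈ Finset.range m,
          ((((m + 1).choose (i + 2) : ℝ) * (2 * L) ^ (i + 2) * (-1) ^ (m - 1 - i) : ℝ) : ℂ) *
            (((L : ℂ) - I * ξ) ^ (i + 2))⁻¹ := by
  have hw := cayleyDen_ne_zero hL ξ
  have hexp : Complex.exp (((((m + 1 : ℕ) : ℝ) * (2 * Real.arctan (ξ / L)) : ℝ) : ℂ) * I)
      = (((L : ℂ) + I * ξ) / ((L : ℂ) - I * ξ)) ^ (m + 1) := by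
    rw [← cexp_cayleyAngle_mul_I hL, ← Complex.exp_nat_mul]
    push_cast
    ring_nf
  have ha : (L : ℂ) + I * ξ = 2 * L + -((L : ℂ) - I * ξ) := by ring
  -- expand `((2L − w)/w)^{m+1}` binomially and peel off the terms `j = 0, 1`
  have hsum : (((L : ℂ) + I * ξ) / ((L : ℂ) - I * ξ)) ^ (m + 1) =
      ∑ j ∈ Finset.range (m + 2), (((m + 1).choose j : ℝ) : ℂ) * (2 * L) ^ j * (-1) ^ (m + 1 - j) *
        (((L : ℂ) - I * ξ) ^ j)⁻¹ := by
    rw [div_pow, ha, add_pow, Finset.sum_div]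
    refine Finset.sum_congr rfl fun j hj => ?_
    have hj' : j ≤ m + 1 := Nat.lt_succ_iff.mp (Finset.mem_range.mp hj)
    rw [neg_pow, show (((L : ℂ) - I * ξ) ^ (m + 1)) = ((L : ℂ) - I * ξ) ^ (m + 1 - j) * ((L : ℂ) - I * ξ) ^ j by
      rw [← pow_add]; congr 1; omega]
    push_cast
    field_simp
  have hreindex : ∑ i ∈ Finset.range m, (((m + 1).choose (i + 1 + 1) : ℝ) : ℂ) * (2 * L) ^ (i + 1 + 1) *
      (-1) ^ (m + 1 - (i + 1 + 1)) * (((L : ℂ) - I * ξ) ^ (i + 1 + 1))⁻¹ =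
      ∑ i ∈ Finset.range m, ((((m + 1).choose (i + 2) : ℝ) * (2 * L) ^ (i + 2) * (-1) ^ (m - 1 - i) : ℝ) : ℂ) *
        (((L : ℂ) - I * ξ) ^ (i + 2))⁻¹ := by
    refine Finset.sum_congr rfl fun i hi => ?_
    have hi' : i < m := Finset.mem_range.mp hi
    rw [show m + 1 - (i + 1 + 1) = m - 1 - i by omega, show i + 1 + 1 = i + 2 by ring]
    push_cast
    ring
  rw [hexp, hsum, Finset.sum_range_succ', Finset.sum_range_succ', hreindex]
  set S := ∑ i ∈ Finset.range m, ((((m + 1).choose (i + 2) : ℝ) * (2 * L) ^ (i + 2) * (-1) ^ (m - 1 - i) : ℝ) : ℂ) *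
        (((L : ℂ) - I * ξ) ^ (i + 2))⁻¹ with hS
  simp only [zero_add, Nat.choose_zero_right, Nat.choose_one_right, Nat.add_sub_cancel, Nat.sub_zero, pow_zero,
    pow_one, inv_one, mul_one]
  push_cast
  ring

/-- `cos kθ − (−1)^k` and `sin kθ` are the real and imaginary parts of the span element above (`k = m + 1`). [folklore] -/
theorem cos_sub_sin_cayleyAngle_eq {L : ℝ} (hL : 0 < L) (m : ℕ) (ξ : ℝ) :
    (Real.cos (((m + 1 : ℕ) : ℝ) * (2 * Real.arctan (ξ / L))) - (-1) ^ (m + 1) =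
      ((((2 * (m + 1) * L * (-1) ^ m : ℝ)) : ℂ) * (((L : ℂ) - I * ξ) ^ 1)⁻¹ +
        ∑ i ∈ Finset.range m,
          ((((m + 1).choose (i + 2) : ℝ) * (2 * L) ^ (i + 2) * (-1) ^ (m - 1 - i) : ℝ) : ℂ) *
            (((L : ℂ) - I * ξ) ^ (i + 2))⁻¹).re) ∧
    (Real.sin (((m + 1 : ℕ) : ℝ) * (2 * Real.arctan (ξ / L))) =
      ((((2 * (m + 1) * L * (-1) ^ m : ℝ)) : ℂ) * (((L : ℂ) - I * ξ) ^ 1)⁻¹ +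
        ∑ i ∈ Finset.range m,
          ((((m + 1).choose (i + 2) : ℝ) * (2 * L) ^ (i + 2) * (-1) ^ (m - 1 - i) : ℝ) : ℂ) *
            (((L : ℂ) - I * ξ) ^ (i + 2))⁻¹).im) := by
  rw [← cexp_mul_cayleyAngle_sub_eq_sum hL, Complex.sub_re, Complex.sub_im, Complex.exp_ofReal_mul_I_re,
    Complex.exp_ofReal_mul_I_im]
  refine ⟨?_, ?_⟩
  · congr 1
    rw [show ((-1 : ℂ) ^ (m + 1)) = (((-1 : ℝ) ^ (m + 1) : ℝ) : ℂ) by push_cast; ring, Complex.ofReal_re]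
  · rw [show ((-1 : ℂ) ^ (m + 1)) = (((-1 : ℝ) ^ (m + 1) : ℝ) : ℂ) by push_cast; ring, Complex.ofReal_im, sub_zero]

/-- **`H[sin kθ] = −(cos kθ − (−1)^k)`** for every `k ≥ 1` (`θ = 2·arctan(ξ/L)`, `L > 0`, `H = hilbertTransform` in `ξ`): the engines'
closed form for the Hilbert transform of the sine modes of the Cayley variable (the constant `(−1)^k = cos kπ` is the value at `ξ = ±∞`,
which the line transform of the decaying function `sin kθ` cannot see). [folklore] -/
theorem hilbertTransform_sin_cayleyAngle {L : ℝ} (hL : 0 < L) {k : ℕ} (hk : k ≠ 0) (x : ℝ) :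
    hilbertTransform (fun ξ : ℝ => Real.sin (k * (2 * Real.arctan (ξ / L)))) x =
      -(Real.cos (k * (2 * Real.arctan (x / L))) - (-1) ^ k) := by
  obtain ⟨m, rfl⟩ : ∃ m, k = m + 1 := ⟨k - 1, by omega⟩
  have e : (fun ξ : ℝ => Real.sin (((m + 1 : ℕ) : ℝ) * (2 * Real.arctan (ξ / L)))) = fun ξ : ℝ =>
      ((((2 * (m + 1) * L * (-1) ^ m : ℝ)) : ℂ) * (((L : ℂ) - I * ξ) ^ 1)⁻¹ +
        ∑ i ∈ Finset.range m,
          ((((m + 1).choose (i + 2) : ℝ) * (2 * L) ^ (i + 2) * (-1) ^ (m - 1 - i) : ℝ) : ℂ) *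
            (((L : ℂ) - I * ξ) ^ (i + 2))⁻¹).im := by
    funext ξ; exact (cos_sub_sin_cayleyAngle_eq hL m ξ).2
  have h := (hilbertTransform_cayleySum_one hL (2 * (m + 1) * L * (-1) ^ m)
    (fun i => ((m + 1).choose (i + 2) : ℝ) * (2 * L) ^ (i + 2) * (-1) ^ (m - 1 - i)) m x).2
  rw [e]
  refine h.trans ?_
  rw [(cos_sub_sin_cayleyAngle_eq hL m x).1]

/-- **`H[cos kθ − (−1)^k] = sin kθ`** for every `k ≥ 1` (`θ = 2·arctan(ξ/L)`, `L > 0`). [folklore] -/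
theorem hilbertTransform_cos_sub_cayleyAngle {L : ℝ} (hL : 0 < L) {k : ℕ} (hk : k ≠ 0) (x : ℝ) :
    hilbertTransform (fun ξ : ℝ => Real.cos (k * (2 * Real.arctan (ξ / L))) - (-1) ^ k) x =
      Real.sin (k * (2 * Real.arctan (x / L))) := by
  obtain ⟨m, rfl⟩ : ∃ m, k = m + 1 := ⟨k - 1, by omega⟩
  have e : (fun ξ : ℝ => Real.cos (((m + 1 : ℕ) : ℝ) * (2 * Real.arctan (ξ / L))) - (-1) ^ (m + 1)) = fun ξ : ℝ =>
      ((((2 * (m + 1) * L * (-1) ^ m : ℝ)) : ℂ) * (((L : ℂ) - I * ξ) ^ 1)⁻¹ +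
        ∑ i ∈ Finset.range m,
          ((((m + 1).choose (i + 2) : ℝ) * (2 * L) ^ (i + 2) * (-1) ^ (m - 1 - i) : ℝ) : ℂ) *
            (((L : ℂ) - I * ξ) ^ (i + 2))⁻¹).re := by
    funext ξ; exact (cos_sub_sin_cayleyAngle_eq hL m ξ).1
  have h := (hilbertTransform_cayleySum_one hL (2 * (m + 1) * L * (-1) ^ m)
    (fun i => ((m + 1).choose (i + 2) : ℝ) * (2 * L) ^ (i + 2) * (-1) ^ (m - 1 - i)) m x).1
  rw [e]
  refine h.trans ?_
  rw [(cos_sub_sin_cayleyAngle_eq hL m x).2]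

end SheetRCayleyHilbertModes
end Summit.NavierStokesRegularity.OSWSelfSimilar
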